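import Literature.NumberTheory.LFunctions.ZetaArgRHExtremalBounds
import Literature.NumberTheory.LFunctions.ZetaZeroGapsRHExplicitProofs
import Mathlib.Analysis.Real.Pi.Bounds
import Mathlib.Analysis.Complex.ExponentialBounds
import HarnessLib

/-!
# RH-CONDITIONAL — Goldston–Gonek: short-interval zero counts under RH, and the maximal gap `(π + o(1))/log log γ` PROVED from the Carneiro–Chandee–Milinovich bound via Simonič's gap lemma («nothing here bears on the truth of RH»)

Topic `Literature/NumberTheory/LFunctions` (RH literature-typing tranche 1, L4 "explicit zero
statistics"; companion of `ZetaArgRHExtremalBounds.lean` (CCM 2013: `|S(t)| ≤ (¼+o(1)) log t/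
log log t` on RH) and of `ZetaZeroGapsRHExplicitProofs.lean` (Simonič's RH-free gap lemma,
proved)). Label: **RH-CONDITIONAL** — one published theorem vendored as a NAMED FACT
(`def … : Prop`, D-0014), and one published corollary PROVED from facts already in the tree.
Nothing is asserted about RH; nothing here bears on the truth of RH.

Source: D. A. Goldston, S. M. Gonek, *A note on `S(t)` and the zeros of the Riemann
zeta-function*, Bull. Lond. Math. Soc. **39** (2007) 482–486 (arXiv:math/0511092;
Zbl 1127.11058), Theorem 1 and Corollary 1 (second part), typed from the arXiv TeX source:

* `GoldstonGonek2007_thm1` — **Theorem 1** (NAMED FACT): on RH, for `t` large and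
  `0 < h ≤ √t`, `|N(t+h) − N(t) − (h/2π) log(t/2π)| ≤ (½ + o(1)) log t/log log t`
  (Guinand–Weil explicit formula with the Beurling–Selberg functions; the `o(1)` uniform in `h`;
  rendered as `∀ ε > 0, ∃ t₀, ∀ t ≥ t₀, ∀ h ∈ (0, √t], … ≤ (½ + ε) …`).
* `GoldstonGonek2007_cor1_gap` — **Corollary 1, (1.10)**, PROVED (no new hypothesis beyond facts
  already in the tree): on RH, consecutive ordinates `γ < γ'` satisfy
  `γ' − γ ≤ (π + o(1))/log log γ`; here in the form: `CarneiroChandeeMilinovich2013_thm1 →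
  (RH → ∀ ε > 0, ∃ γ₀, ∀ n, γ_n ≥ γ₀ → γ_{n+1} − γ_n ≤ (π + ε)/log log γ_n)`. The source deduces
  (1.10) from its Theorem 1 ("assume `N(t+h) − N(t) = 0` in (1.5) and solve for `h`"); we deduce
  it from ANY eventual pointwise bound `|S(t)| ≤ (c₀ + o(1)) log t/log log t` through the
  kernel-proved gap lemma `Simonic2022Lemma6.zetaOrdinate_succ_le` (maximal gap
  `≤ (4πc₀ + o(1))/log log γ`, `maxGap_of_eventual_S_bound`), and `c₀ = ¼` is
  Carneiro–Chandee–Milinovich's Theorem 1 (`CarneiroChandeeMilinovich2013_thm1.littlewood`), so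
  `4πc₀ = π` — the printed constant. (Goldston–Gonek's own Theorem 2, `c₀ = ½`, would give `2π`
  by this route; their sharper `π` comes from the `h`-uniform Theorem 1.)

Conventions: `N = zetaZeroCount`, `S = zetaArgS` (Backlund, right-continuous), consecutive
ordinates = `zetaOrdinate n ≤ zetaOrdinate (n+1)` (with multiplicity, as in
`ZetaArgRHExplicit.lean`; a repeated ordinate gives gap `0`). What is deliberately NOT here:
Corollary 1 (1.9) (multiplicity `m(γ) ≤ (½ + o(1)) log γ/log log γ`) and Theorem 2
(`|S(t)| ≤ (½ + o(1)) log t/log log t`, superseded by CCM's `¼`, `ZetaArgRHExtremalBounds.lean`).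

## References

* D. A. Goldston, S. M. Gonek, Bull. Lond. Math. Soc. 39 (2007) 482–486, Thm. 1, Cor. 1
  (arXiv:math/0511092). [GoldstonGonek2007]
* E. Carneiro, V. Chandee, M. B. Milinovich, Math. Ann. 356 (2013) 939–968, Thm. 1.
  [CarneiroChandeeMilinovich2013]
* A. Simonič, J. Number Theory 231 (2022) 464–491, Lemma 6. [Simonic2022]
-/

noncomputable section

open Real

namespace Literature.NumberTheory.LFunctions

open SchoenfeldBound

/-! ## Theorem 1 (named fact) -/

/-- NAMED FACT, RH-CONDITIONAL (Goldston–Gonek 2007, **Theorem 1**, as printed: "Assume the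
Riemann Hypothesis. Let `t` be large and `0 < h ≤ √t`. Then we have
`|N(t+h) − N(t) − (h/2π) log(t/2π)| ≤ (½ + o(1)) log t/log log t`."). The `o(1)` (uniform in
`h ∈ (0, √t]`) and "large" are rendered as `∀ ε > 0, ∃ t₀, …`. `N = zetaZeroCount` (zeros with
`0 < γ ≤ T`, multiplicity). Users take `(h : GoldstonGonek2007_thm1)` and RH.
[cite: GoldstonGonek2007, Thm. 1] -/
def GoldstonGonek2007_thm1 : Prop :=
  RiemannHypothesis →
    ∀ ε : ℝ, 0 < ε → ∃ t₀ : ℝ, ∀ t : ℝ, t₀ ≤ t → ∀ h : ℝ, 0 < h → h ≤ Real.sqrt t →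
      |((zetaZeroCount (t + h) : ℝ) - zetaZeroCount t) - h / (2 * π) * Real.log (t / (2 * π))| ≤
        (1 / 2 + ε) * Real.log t / Real.log (Real.log t)

/-! ## The maximal gap from an eventual pointwise bound on `S(t)` (RH-free engine) -/

/-- `log(2π) < 1.86`. [folklore] -/
private theorem log_two_pi_lt : Real.log (2 * π) < 1.86 := by
  have hπ : 0 < π := Real.pi_pos
  have hπ3 : π < 3.15 := Real.pi_lt_d2
  have he := Real.exp_one_gt_d9
  have h2 := Real.log_two_lt_d9
  have hlogπ : Real.log π ≤ π / Real.exp 1 := by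
    have h := Real.log_le_sub_one_of_pos (x := π / Real.exp 1) (by positivity)
    rw [Real.log_div hπ.ne' (Real.exp_pos 1).ne', Real.log_exp] at h
    linarith
  have hq : π / Real.exp 1 < 1.16 := by
    rw [div_lt_iff₀ (Real.exp_pos 1)]; linarith
  rw [Real.log_mul (by norm_num) hπ.ne']
  linarith

/-- **Maximal gap from an eventual `S`-bound** (RH-free): if `|S(t)| ≤ c log t/log log t` for all
`t ≥ t₁` with `c > 0`, then for every `C > 4πc` there is `γ₀` such that consecutive ordinates
`γ_n ≥ γ₀` satisfy `γ_{n+1} − γ_n ≤ C/log log γ_n` — Simonič's gap lemma (pointwise form,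
`Simonic2022Lemma6.zetaOrdinate_succ_le`, with the tree's proved remainder `(1.2/π)/t`) at all
large heights. [cite: Simonic2022, Lemma 6] -/
theorem maxGap_of_S_bound {c C t₁ : ℝ} (hc : 0 < c) (hC : 4 * π * c < C)
    (hS : ∀ t : ℝ, t₁ ≤ t → |zetaArgS t| ≤ c * Real.log t / Real.log (Real.log t)) :
    ∃ γ₀ : ℝ, ∀ n : ℕ, γ₀ ≤ zetaOrdinate n →
      zetaOrdinate (n + 1) - zetaOrdinate n ≤ C / Real.log (Real.log (zetaOrdinate n)) := by
  have hπ : 0 < π := Real.pi_pos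
  have hπ3 : 3 < π := Real.pi_gt_three
  -- the margin `δ = C/(2π) − 2c > 0` and the constant `M` to beat
  set δ : ℝ := C / (2 * π) - 2 * c with hδ
  have hδ0 : 0 < δ := by
    rw [hδ, sub_pos, lt_div_iff₀ (by positivity)]; linarith
  have hC0 : 0 < C := lt_trans (by positivity) hC
  set M : ℝ := C / (2 * π) * 1.86 + 2 * (1.2 / π) + C * c with hM
  have hM0 : 0 < M := by positivity
  refine ⟨max (max t₁ 16) (Real.exp (M / δ + 1)), fun n hn ↦ ?_⟩
  set T := zetaOrdinate n with hTdef
  have ht₁ : t₁ ≤ T := le_trans (le_trans (le_max_left _ _) (le_max_left _ _)) hn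
  have hT16 : (16 : ℝ) ≤ T := le_trans (le_trans (le_max_right _ _) (le_max_left _ _)) hn
  have hTexp : Real.exp (M / δ + 1) ≤ T := le_trans (le_max_right _ _) hn
  clear hn
  have hT0 : 0 < T := by linarith
  have he1 := Real.exp_one_lt_d9
  have he : Real.exp 1 < T := by linarith
  have h2T : (2 : ℝ) ≤ T := by linarith
  have hL1 : 1 < Real.log T := by
    rw [← Real.exp_lt_exp, Real.exp_log hT0]; exact he
  -- log log T ≥ 1 (log T ≥ e since T ≥ 16 > e^e)
  have hLe : Real.exp 1 ≤ Real.log T := by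
    rw [← Real.log_exp (Real.exp 1)]
    refine Real.log_le_log (Real.exp_pos _) (le_trans ?_ hT16)
    have : Real.exp (Real.exp 1) ≤ Real.exp 2.72 := Real.exp_le_exp.2 (by linarith)
    have h272 : Real.exp 2.72 ≤ 16 := by
      have hb := Real.exp_bound' (x := (0.72 : ℝ)) (by norm_num) (by norm_num) (n := 4) (by norm_num)
      simp only [Finset.sum_range_succ, Finset.sum_range_zero, Nat.factorial] at hb
      norm_num at hb
      have e3 : Real.exp 2.72 = Real.exp 1 ^ 2 * Real.exp 0.72 := by
        rw [← Real.exp_nat_mul, ← Real.exp_add]; norm_num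
      rw [e3]
      have hE : Real.exp 1 ^ 2 ≤ 2.7182818286 ^ 2 := pow_le_pow_left₀ (Real.exp_pos 1).le he1.le 2
      have hE0 : 0 ≤ Real.exp 0.72 := (Real.exp_pos _).le
      nlinarith
    linarith
  have hLL1 : 1 ≤ Real.log (Real.log T) := by
    rw [← Real.log_exp 1]; exact Real.log_le_log (Real.exp_pos 1) hLe
  have hLL0 : 0 < Real.log (Real.log T) := by linarith
  have hL0 : 0 < Real.log T := by linarith
  have hlogT : M / δ + 1 ≤ Real.log T := by
    rw [← Real.log_exp (M / δ + 1)]; exact Real.log_le_log (Real.exp_pos _) hTexp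
  -- the two S-bounds
  have hS₀ : |zetaArgS T| ≤ c * Real.log T / Real.log (Real.log T) := hS T ht₁
  have hCnn : 0 ≤ C := hC0.le
  have hH : 0 ≤ C / Real.log (Real.log T) := div_nonneg hCnn hLL0.le
  have hS₁ : |zetaArgS (T + C / Real.log (Real.log T))| ≤
      c * Real.log (T + C / Real.log (Real.log T)) /
        Real.log (Real.log (T + C / Real.log (Real.log T))) := hS _ (by linarith)
  -- condition (⋆)
  have hcond : 2 * c * Real.log T + 2 * (1.2 / π) * Real.log (Real.log T) / T <
      C * (Real.log (T / (2 * π)) / (2 * π) - c / (T * Real.log (Real.log T))) := by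
    have hlogdiv : Real.log (T / (2 * π)) = Real.log T - Real.log (2 * π) :=
      Real.log_div hT0.ne' (by positivity)
    rw [hlogdiv]
    have hl2p := log_two_pi_lt
    have hl2p0 : 0 < Real.log (2 * π) := Real.log_pos (by linarith)
    -- small terms
    have hLLT : Real.log (Real.log T) ≤ T := by
      have h1 : Real.log (Real.log T) ≤ Real.log T := by
        have := Real.log_le_sub_one_of_pos hL0; linarith
      have h2 : Real.log T ≤ T := by
        have := Real.log_le_sub_one_of_pos hT0; linarith
      linarith
    have hsmall1 : 2 * (1.2 / π) * Real.log (Real.log T) / T ≤ 2 * (1.2 / π) := by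
      rw [div_le_iff₀ hT0]
      have : 0 < 2 * (1.2 / π) := by positivity
      nlinarith
    have hsmall2 : C * (c / (T * Real.log (Real.log T))) ≤ C * c := by
      refine mul_le_mul_of_nonneg_left ?_ hCnn
      rw [div_le_iff₀ (by positivity)]
      have : 1 ≤ T * Real.log (Real.log T) := by nlinarith
      nlinarith
    have hsmall3 : C / (2 * π) * Real.log (2 * π) ≤ C / (2 * π) * 1.86 :=
      mul_le_mul_of_nonneg_left hl2p.le (by positivity)
    -- main: δ log T > M
    have hmainδ : M < δ * Real.log T := by
      have h1 : M / δ < Real.log T := by linarith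
      rwa [div_lt_iff₀ hδ0, mul_comm] at h1
    have e : C * ((Real.log T - Real.log (2 * π)) / (2 * π) - c / (T * Real.log (Real.log T))) =
        C / (2 * π) * Real.log T - C / (2 * π) * Real.log (2 * π)
          - C * (c / (T * Real.log (Real.log T))) := by
      ring
    rw [e]
    have e2 : δ * Real.log T = C / (2 * π) * Real.log T - 2 * c * Real.log T := by
      rw [hδ]; ring
    rw [e2] at hmainδ
    rw [hM] at hmainδ
    linarith
  have h := Simonic2022Lemma6.zetaOrdinate_succ_le (A := 1.2 / π) (t₁ := 2) (n := n) (by norm_num)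
    (fun t ht ↦ abs_count_sub_countMain_sub_zetaArgS_le ht) h2T he hc.le hCnn hS₀ hS₁ hcond le_rfl
  exact sub_le_iff_le_add'.2 h

/-- Variant with an "`o(1)`" hypothesis: if for every `η > 0` eventually
`|S(t)| ≤ (c₀ + η) log t/log log t` (`c₀ ≥ 0`), then for every `ε > 0` eventually
`γ_{n+1} − γ_n ≤ (4πc₀ + ε)/log log γ_n`. [cite: Simonic2022, Lemma 6] -/
theorem maxGap_of_eventual_S_bound {c₀ : ℝ} (hc₀ : 0 ≤ c₀)
    (hS : ∀ η : ℝ, 0 < η → ∃ t₁ : ℝ, ∀ t : ℝ, t₁ ≤ t →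
      |zetaArgS t| ≤ (c₀ + η) * Real.log t / Real.log (Real.log t))
    {ε : ℝ} (hε : 0 < ε) :
    ∃ γ₀ : ℝ, ∀ n : ℕ, γ₀ ≤ zetaOrdinate n →
      zetaOrdinate (n + 1) - zetaOrdinate n ≤ (4 * π * c₀ + ε) / Real.log (Real.log (zetaOrdinate n)) := by
  have hπ : 0 < π := Real.pi_pos
  have hπ4 : π < 4 := Real.pi_lt_four
  -- η = ε/(8π): 4π(c₀ + η) = 4πc₀ + ε/2 < 4πc₀ + ε
  obtain ⟨t₁, ht₁⟩ := hS (ε / (8 * π)) (by positivity)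
  refine maxGap_of_S_bound (c := c₀ + ε / (8 * π)) (by positivity) ?_ ht₁
  have e : 4 * π * (c₀ + ε / (8 * π)) = 4 * π * c₀ + ε / 2 := by field_simp; ring
  rw [e]; linarith

/-! ## Corollary 1 (1.10) from Carneiro–Chandee–Milinovich -/

/-- **Goldston–Gonek 2007, Corollary 1, (1.10)**, PROVED from the Carneiro–Chandee–Milinovich
bound: on RH, "if `γ` and `γ'` are consecutive ordinates and `γ < γ'`, then
`γ' − γ ≤ (π/log log γ)(1 + o(1))`" — here: `CarneiroChandeeMilinovich2013_thm1 → RH → ∀ ε > 0,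
∃ γ₀, ∀ n, γ_n ≥ γ₀ → γ_{n+1} − γ_n ≤ (π + ε)/log log γ_n` (the gap lemma with `c₀ = ¼`:
`4π · ¼ = π`). [cite: GoldstonGonek2007, Cor. 1 (1.10)] -/
theorem GoldstonGonek2007_cor1_gap (h : CarneiroChandeeMilinovich2013_thm1)
    (hRH : RiemannHypothesis) {ε : ℝ} (hε : 0 < ε) :
    ∃ γ₀ : ℝ, ∀ n : ℕ, γ₀ ≤ zetaOrdinate n →
      zetaOrdinate (n + 1) - zetaOrdinate n ≤ (π + ε) / Real.log (Real.log (zetaOrdinate n)) := by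
  have hS : ∀ η : ℝ, 0 < η → ∃ t₁ : ℝ, ∀ t : ℝ, t₁ ≤ t →
      |zetaArgS t| ≤ (1 / 4 + η) * Real.log t / Real.log (Real.log t) :=
    fun η hη ↦ CarneiroChandeeMilinovich2013_thm1.littlewood h hRH hη
  have := maxGap_of_eventual_S_bound (c₀ := 1 / 4) (by norm_num) hS hε
  have e : 4 * π * (1 / 4 : ℝ) + ε = π + ε := by ring
  rwa [e] at this

end Literature.NumberTheory.LFunctions

end
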